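import Literature.Probability.Percolation.TwoSetExchange
import HarnessLib

/-!
# `NoHeavyLowerTail` (stmt-CriticalPhenomena-4575) — the ISOLATION EXCHANGE inequality
# (given `S ↮ T`, an `S`-connection and a `T`-connection are negatively correlated)

Support file (prover `prim-hp-4`, hull-port prover #4, LP-duality technique; `--supports stmt-CriticalPhenomena-4575`).
No definitions, no named facts, no sorries.

`isolation_exchange`: for vertex sets `S, T`, vertices `s₀ ∈ S`, `t₀ ∈ T` and any vertices `o, v`, with `D = {S ↮ T}`
(no open path from `S` to `T`) and `μ = prodBernoulli w`,
    μ(D, s₀ ↔ o, t₀ ↔ v) · μ(D) ≤ μ(D, s₀ ↔ o) · μ(D, t₀ ↔ v).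
This is the instance `A₁ = {s₀ ↔ o}` (type `(+)`), `B₁ = {t₀ ↔ v}` (type `(−)`), `A₂ = B₂ = univ` of the two-set two-cluster
exchange inequality of van den Berg–Häggström–Kahn (2006, Thm. 1.5; the tree's `setTwoClusterExchange`).
USE (memo `run/shared/lean/prim/prim-hp-4/HULLPORT-LP.md` §9): the sign conditions of the three-port attached-form certificate
`XZport₃` (`…XZportThreeCore`) are instances in the observer's region graph — (Q2): `S = {3}`, `T = {1,2}`, `o` the observer,
`v = 2`: "given that port 3 is inner-separated from ports 1, 2, the events {3 ↔ o} and {1 ↔ 2} are negatively correlated",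
i.e. `P(S_o = {3}, [1] = {1,2})·P([3] = {3}) ≤ P(S_o = {3})·P([1] = {1,2})`; (Q4): `S = {2}`, `T = {1,3}`, `v = 3`.
-/

noncomputable section

namespace Summit.CriticalPhenomena.PercolationContinuityZ3.Theorems

open MeasureTheory Set Literature.Probability.LatticeModels Literature.Probability.Percolation
open scoped Classical BigOperators

variable {n : ℕ}

namespace IsolationExchange

/-- **Isolation exchange** (BHK 2006 Thm. 1.5 via `setTwoClusterExchange`): with `D = {S ↮ T}`, `s₀ ∈ S`, `t₀ ∈ T`,
`μ(D ∩ ({s₀ ↔ o} ∩ {t₀ ↔ v})) · μ(D) ≤ μ(D ∩ {s₀ ↔ o}) · μ(D ∩ {t₀ ↔ v})`.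
[derived from: VandenbergHaggstromKahn2005, Thm. 1.5 (two-set form) — `setTwoClusterExchange`] -/
theorem isolation_exchange (w : Sym2 (Fin n) → unitInterval) (S T : Set (Fin n)) {s₀ t₀ : Fin n}
    (hs₀ : s₀ ∈ S) (ht₀ : t₀ ∈ T) (o v : Fin n) :
    (prodBernoulli w).real ({ω : BondConfig (Fin n) | ∀ s ∈ S, ∀ t ∈ T, ¬ (openGraph ω).Reachable s t} ∩
        ((openConn s₀ o : Set (BondConfig (Fin n))) ∩ (openConn t₀ v : Set (BondConfig (Fin n))))) *
      (prodBernoulli w).real {ω : BondConfig (Fin n) | ∀ s ∈ S, ∀ t ∈ T, ¬ (openGraph ω).Reachable s t} ≤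
    (prodBernoulli w).real ({ω : BondConfig (Fin n) | ∀ s ∈ S, ∀ t ∈ T, ¬ (openGraph ω).Reachable s t} ∩
        (openConn s₀ o : Set (BondConfig (Fin n)))) *
      (prodBernoulli w).real ({ω : BondConfig (Fin n) | ∀ s ∈ S, ∀ t ∈ T, ¬ (openGraph ω).Reachable s t} ∩
        (openConn t₀ v : Set (BondConfig (Fin n)))) := by
  have key := setTwoClusterExchange w S T
    (A₁ := (openConn s₀ o : Set (BondConfig (Fin n)))) (A₂ := (univ : Set (BondConfig (Fin n))))
    (B₁ := (openConn t₀ v : Set (BondConfig (Fin n)))) (B₂ := (univ : Set (BondConfig (Fin n))))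
    (fun ω ω' hs ht h => TwoSetExchange.typePlus_openConn_of_mem S T hs₀ o hs ht h)
    (fun _ _ _ _ _ => mem_univ _)
    (fun ω ω' hs ht h => TwoSetExchange.typeMinus_openConn_of_mem S T ht₀ v hs ht h)
    (fun _ _ _ _ _ => mem_univ _)
  simpa only [inter_univ, univ_inter] using key

/-- The same inequality with the connection events written as `{ω | ω ∈ openConn …}`-style intersections in the other
order: `μ(D ∩ {t₀ ↔ v} ∩ {s₀ ↔ o}) · μ(D) ≤ μ(D ∩ {s₀ ↔ o}) · μ(D ∩ {t₀ ↔ v})`. -/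
theorem isolation_exchange' (w : Sym2 (Fin n) → unitInterval) (S T : Set (Fin n)) {s₀ t₀ : Fin n}
    (hs₀ : s₀ ∈ S) (ht₀ : t₀ ∈ T) (o v : Fin n) :
    (prodBernoulli w).real (({ω : BondConfig (Fin n) | ∀ s ∈ S, ∀ t ∈ T, ¬ (openGraph ω).Reachable s t} ∩
        (openConn t₀ v : Set (BondConfig (Fin n)))) ∩ (openConn s₀ o : Set (BondConfig (Fin n)))) *
      (prodBernoulli w).real {ω : BondConfig (Fin n) | ∀ s ∈ S, ∀ t ∈ T, ¬ (openGraph ω).Reachable s t} ≤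
    (prodBernoulli w).real ({ω : BondConfig (Fin n) | ∀ s ∈ S, ∀ t ∈ T, ¬ (openGraph ω).Reachable s t} ∩
        (openConn s₀ o : Set (BondConfig (Fin n)))) *
      (prodBernoulli w).real ({ω : BondConfig (Fin n) | ∀ s ∈ S, ∀ t ∈ T, ¬ (openGraph ω).Reachable s t} ∩
        (openConn t₀ v : Set (BondConfig (Fin n)))) := by
  rw [inter_assoc, inter_comm (openConn t₀ v : Set (BondConfig (Fin n)))]
  exact isolation_exchange w S T hs₀ ht₀ o v

end IsolationExchange

end Summit.CriticalPhenomena.PercolationContinuityZ3.Theorems
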